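import Summits.BirchSwinnertonDyer.BirchSwinnertonDyer.Theorems.CyclotomicUntwistEigensymbolPushforward
import HarnessLib

/-!
# Untwist eigensymbols, II: the value of the twisted push-forward at a character of `Γ`, and its
# evaluation at the level of the primitive character (D1 `IsUntwistedPAdicLFunction` currency)

Cell `pub/bsd-wall` (D-0145 line `route-BirchSwinnertonDyer-CyclotomicUntwist`), seat `bsd-line-cycu-p3`
(prover seat 3/3), helper toward crux K1 `PSRankOneLowerHalfAtThree` (stmt-BirchSwinnertonDyer-21580) —
toward its EXISTENCE want F1 (`wi-84943`).  Second of three files (`…EigensymbolPushforward` → this →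
`…UntwistedLFunctionExistence`).  THEOREMS ONLY (no definition, no named fact, no `sorry`).  BSD is not
proved by this file and no crux of the route is proved by it.

CONTENTS (notation of file I: `ν L a = α^{-L}Φ(a/p^L)`, `L` its `η̄`-twisted push-forward to `Γ`).
§4 `gammaCharValue_pushforward`: for a Dirichlet character `ξ` mod `p^m` that is a character of `Γ` (even,
`p`-power order), `∫_Γ ξ dL = ∑_{s} ξ(γ^s) L(γ^sΓ^{p^m}) = ∑_{u ∈ (ℤ/p^{m+e₀+c})^×} ξ(u) η(u)⁻¹ ν(u)` — on the
classes over `ζγ^s`, `ξ(u) = ξ(ζ)ξ(γ^s) = ξ(γ^s)` (tree `apply_toZModPow_rootsOfUnity`), and the classes run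
over the units once (tree `finsum_sum_classes_eq_sum_units`) (Mazur–Tate–Teitelbaum 1986 §I.13,
`L_p(χ) = ∫_{ℤ_p^×} χ dμ`).  §5: the two evaluations the interpolation clause of D1 needs —
`sum_mul_symbolMeasure_succ`: for `χ` PRIMITIVE mod `p^{k+1}`,
`∑_a χ(a) ν(a + p^{k+1}ℤ_p) = α^{-(k+1)} ∑_a ∑_b χ(a)η(b)[a/p^{k+1} + b/p^c]⁺_f = e_{k+1}(α) · untwistSymbolSum p f η χ`,
from the DEPRIVATION identity (S3) `Φ(r) − (α/p)Φ(pr) = ∑_b η(b)[r + b/p^c]⁺_f` and `ℤ`-periodicity (S1)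
— both needed, and stated, only at the points `r = a/pⁿ` of `ℤ[1/p]` (`a : ℤ`) —
(the term `(α/p)Φ(a/p^k)` only depends on `a mod p^k` and the coset sums of `χ` vanish — tree
`sum_fiber_eq_zero_of_not_factorsThrough`; MTT §I.14, proof of (14.3)); and at the trivial character
`sum_units_symbolMeasure_level_one`: `ν(ℤ_p^×) = (1 − α⁻¹)Φ(0)`, matched with
`untwistMultiplier_zero_mul_untwistSymbolSum`: `e_0(α) · untwistSymbolSum = (1 − α⁻¹)(1 − α/p)⁻¹(1 − α/p)Φ(0)`
for `α ≠ p` (the passage `{∞,0}_g = (1 − α/p)⁻¹{∞,0}_{f⊗η̄}` built into `untwistMultiplier p α 0`).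

References: [cite: MazurTateTeitelbaum1986Invent, §I.13–§I.14] · [cite: Bellaiche2021, §6.7.3 and Thm. 6.7.9].
-/

noncomputable section

open Finset
open Literature.NumberTheory.EllipticCurves Literature.NumberTheory.EllipticCurves.ModularForms
  Literature.NumberTheory.IwasawaTheory

-- single-conjunct summit: `Summit.BirchSwinnertonDyer.BirchSwinnertonDyer.…` repeats the name by design
set_option linter.dupNamespace false

namespace Summit.BirchSwinnertonDyer.BirchSwinnertonDyer.Theorems.PSUntwistExistence

variable {p : ℕ} [Fact p.Prime]

variable {α : ℂ_[p]} {Φ : ℚ → ℂ_[p]} {ν : (n : ℕ) → ZMod (p ^ n) → ℂ_[p]}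
  {c : ℕ} {η : DirichletCharacter ℂ_[p] (p ^ c)} {L : (n : ℕ) → ZMod (p ^ n) → ℂ_[p]}

/-! ### §4 The value at a character of `Γ` is a twisted Gauss sum of `ν` over the units -/

/-- **Units over units**: for `1 ≤ K₀ ≤ K`, summing `G` over the units mod `p^K` is summing, over the
units `u` mod `p^{K₀}`, the fibre sums of `G` over `u` (a class mod `p^K` is a unit iff its reduction is).
[folklore] -/
theorem sum_units_eq_sum_units_sum_fiber {M : Type*} [AddCommMonoid M] {K₀ K : ℕ} (h0 : 1 ≤ K₀)
    (h : K₀ ≤ K) (G : ZMod (p ^ K) → M) :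
    ∑ b : (ZMod (p ^ K))ˣ, G b =
      ∑ u : (ZMod (p ^ K₀))ˣ, ∑ b ∈ univ.filter (fun b : ZMod (p ^ K) ↦
        ZMod.castHom (pow_dvd_pow p h) (ZMod (p ^ K₀)) b = u), G b := by
  classical
  haveI : NeZero (p ^ K) := ⟨pow_ne_zero _ (Fact.out : p.Prime).ne_zero⟩
  haveI : NeZero (p ^ K₀) := ⟨pow_ne_zero _ (Fact.out : p.Prime).ne_zero⟩
  rw [sum_units_eq_sum_filter_isUnit (F := G),
    sum_units_eq_sum_filter_isUnit (F := fun u : ZMod (p ^ K₀) ↦ ∑ b ∈ univ.filter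
      (fun b : ZMod (p ^ K) ↦ ZMod.castHom (pow_dvd_pow p h) (ZMod (p ^ K₀)) b = u), G b),
    ← Finset.sum_fiberwise (univ.filter fun b : ZMod (p ^ K) ↦ IsUnit b)
      (ZMod.castHom (pow_dvd_pow p h) (ZMod (p ^ K₀))), Finset.sum_filter]
  refine Finset.sum_congr rfl fun u _ ↦ ?_
  split_ifs with hu
  · refine Finset.sum_congr ?_ fun _ _ ↦ rfl
    ext b
    simp only [Finset.mem_filter, Finset.mem_univ, true_and, and_iff_right_iff_imp]
    intro hb
    rw [isUnit_iff_isUnit_castHom h0 h, hb]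
    exact hu
  · refine Finset.sum_eq_zero fun b hb ↦ ?_
    simp only [Finset.mem_filter, Finset.mem_univ, true_and] at hb
    exact absurd (hb.2 ▸ (isUnit_iff_isUnit_castHom h0 h b).mp hb.1) hu

/-- **`∫_Γ ξ dL` as a twisted Gauss sum of `ν`.**  For the twisted push-forward `L` of `ν` (as in
`isGammaDistribution_pushforward`) and a Dirichlet character `ξ` mod `p^m` that is a character of `Γ`
(even, of `p`-power order):
`∑_{s mod p^m} ξ(γ^s) L(γ^sΓ^{p^m}) = ∑_{u ∈ (ℤ/p^{m+e₀+c})^×} ξ(u) η(u)⁻¹ ν(u + p^{m+e₀+c}ℤ_p)` —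
on the classes over `ζγ^s` one has `ξ(u) = ξ(ζ)ξ(γ^s) = ξ(γ^s)` (`ξ(ζ) = 1`, tree
`apply_toZModPow_rootsOfUnity`), and the classes `ζγ^s` run over `(ℤ/p^{m+e₀})^×` exactly once (tree
`finsum_sum_classes_eq_sum_units`) (Mazur–Tate–Teitelbaum 1986, §I.13: `L_p(χ) = ∫_{ℤ_p^×} χ dμ`).
[cite: MazurTateTeitelbaum1986Invent, §I.13] -/
theorem gammaCharValue_pushforward
    (hL : ∀ (n : ℕ) (s : ZMod (p ^ n)), L n s =
      ∑ᶠ ζ : rootsOfUnity (torsionOrder p) ℤ_[p],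
        ∑ b ∈ univ.filter (fun b : ZMod (p ^ (n + cyclotomicExponent p + c)) ↦
          ZMod.castHom (pow_dvd_pow p (Nat.le_add_right _ c)) (ZMod (p ^ (n + cyclotomicExponent p))) b =
            classOf p n ζ s),
          (η (ZMod.castHom (pow_dvd_pow p (Nat.le_add_left c _)) (ZMod (p ^ c)) b))⁻¹ *
            ν (n + cyclotomicExponent p + c) b)
    {m : ℕ} (ξ : DirichletCharacter ℂ_[p] (p ^ m)) (heven : ξ.Even) (hord : ∃ j : ℕ, orderOf ξ = p ^ j) :
    gammaCharValue p L ξ =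
      ∑ u : (ZMod (p ^ (m + cyclotomicExponent p + c)))ˣ,
        ξ (ZMod.castHom (pow_dvd_pow p (by omega : m ≤ m + cyclotomicExponent p + c)) (ZMod (p ^ m))
            (u : ZMod (p ^ (m + cyclotomicExponent p + c)))) *
          ((η (ZMod.castHom (pow_dvd_pow p (Nat.le_add_left c (m + cyclotomicExponent p))) (ZMod (p ^ c))
              (u : ZMod (p ^ (m + cyclotomicExponent p + c)))))⁻¹ *
            ν (m + cyclotomicExponent p + c) u) := by
  classical
  haveI := neZero_torsionOrder p
  haveI := Fintype.ofFinite (rootsOfUnity (torsionOrder p) ℤ_[p])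
  have hm : m ≤ m + cyclotomicExponent p := Nat.le_add_right m _
  have hmc : m + cyclotomicExponent p ≤ m + cyclotomicExponent p + c := Nat.le_add_right _ c
  have h1 : 1 ≤ m + cyclotomicExponent p := by
    have := cyclotomicExponent_ne_zero p; omega
  rw [gammaCharValue_def]
  simp only [hL, finsum_eq_sum_of_fintype, Finset.mul_sum]
  -- `ξ(γ^s) = ξ(b mod p^m)` on the classes `b` over `ζ γ^s`
  have hpt : ∀ (s : ZMod (p ^ m)) (ζ : rootsOfUnity (torsionOrder p) ℤ_[p]),
      ∀ b ∈ univ.filter (fun b : ZMod (p ^ (m + cyclotomicExponent p + c)) ↦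
        ZMod.castHom (pow_dvd_pow p hmc) (ZMod (p ^ (m + cyclotomicExponent p))) b = classOf p m ζ s),
      ξ ((cyclotomicGenerator p : ZMod (p ^ m)) ^ s.val) *
          ((η (ZMod.castHom (pow_dvd_pow p (Nat.le_add_left c _)) (ZMod (p ^ c)) b))⁻¹ *
            ν (m + cyclotomicExponent p + c) b) =
        ξ (ZMod.castHom (pow_dvd_pow p (hm.trans hmc)) (ZMod (p ^ m)) b) *
          ((η (ZMod.castHom (pow_dvd_pow p (Nat.le_add_left c _)) (ZMod (p ^ c)) b))⁻¹ *
            ν (m + cyclotomicExponent p + c) b) := by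
    intro s ζ b hb
    have hcast : ZMod.castHom (pow_dvd_pow p (hm.trans hmc)) (ZMod (p ^ m)) b =
        PadicInt.toZModPow m ((ζ : ℤ_[p]ˣ) : ℤ_[p]) * (cyclotomicGenerator p : ZMod (p ^ m)) ^ s.val := by
      rw [← castHom_castHom_zmod (pow_dvd_pow p hm) (pow_dvd_pow p hmc) b, (Finset.mem_filter.mp hb).2,
        classOf_def, map_mul, map_pow, map_natCast, ZMod.castHom_apply, PadicInt.cast_toZModPow _ _ hm]
    rw [hcast, map_mul, map_pow, apply_toZModPow_rootsOfUnity ξ heven hord ζ, one_mul]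
  rw [Finset.sum_congr rfl fun s _ ↦ Finset.sum_congr rfl fun ζ _ ↦ Finset.sum_congr rfl (hpt s ζ),
    Finset.sum_comm, ← finsum_eq_sum_of_fintype]
  -- the classes `ζ γ^s` run over the units mod `p^{m+e₀}`
  rw [show (∑ᶠ ζ : rootsOfUnity (torsionOrder p) ℤ_[p], ∑ s : ZMod (p ^ m),
      ∑ b ∈ univ.filter (fun b : ZMod (p ^ (m + cyclotomicExponent p + c)) ↦
        ZMod.castHom (pow_dvd_pow p hmc) (ZMod (p ^ (m + cyclotomicExponent p))) b = classOf p m ζ s),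
        ξ (ZMod.castHom (pow_dvd_pow p (hm.trans hmc)) (ZMod (p ^ m)) b) *
          ((η (ZMod.castHom (pow_dvd_pow p (Nat.le_add_left c _)) (ZMod (p ^ c)) b))⁻¹ *
            ν (m + cyclotomicExponent p + c) b)) =
      ∑ u : (ZMod (p ^ (m + cyclotomicExponent p)))ˣ,
        ∑ b ∈ univ.filter (fun b : ZMod (p ^ (m + cyclotomicExponent p + c)) ↦
          ZMod.castHom (pow_dvd_pow p hmc) (ZMod (p ^ (m + cyclotomicExponent p))) b = u),
          ξ (ZMod.castHom (pow_dvd_pow p (hm.trans hmc)) (ZMod (p ^ m)) b) *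
            ((η (ZMod.castHom (pow_dvd_pow p (Nat.le_add_left c _)) (ZMod (p ^ c)) b))⁻¹ *
              ν (m + cyclotomicExponent p + c) b) from
    finsum_sum_classes_eq_sum_units p m (fun u ↦
      ∑ b ∈ univ.filter (fun b : ZMod (p ^ (m + cyclotomicExponent p + c)) ↦
          ZMod.castHom (pow_dvd_pow p hmc) (ZMod (p ^ (m + cyclotomicExponent p))) b = u),
          ξ (ZMod.castHom (pow_dvd_pow p (hm.trans hmc)) (ZMod (p ^ m)) b) *
            ((η (ZMod.castHom (pow_dvd_pow p (Nat.le_add_left c _)) (ZMod (p ^ c)) b))⁻¹ *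
              ν (m + cyclotomicExponent p + c) b)),
    ← sum_units_eq_sum_units_sum_fiber h1 hmc]

/-! ### §5 Evaluation at the level of the primitive character -/

/-- **Reductions of a unit are casts of one integer prime to `p`**: for `u ∈ (ℤ/p^K)^×`, `1 ≤ K`, the
integer `a = u.val` is prime to `p` and reduces to `u mod p^k` for every `k ≤ K`. [folklore] -/
theorem castHom_units_eq_natCast_val {K k : ℕ} (hk : k ≤ K) (u : (ZMod (p ^ K))ˣ) :
    ZMod.castHom (pow_dvd_pow p hk) (ZMod (p ^ k)) (u : ZMod (p ^ K)) =
      (((u : ZMod (p ^ K)).val : ℕ) : ZMod (p ^ k)) := by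
  haveI : NeZero (p ^ K) := ⟨pow_ne_zero _ (Fact.out : p.Prime).ne_zero⟩
  rw [ZMod.castHom_apply, ZMod.cast_eq_val]

omit [Fact p.Prime] in
/-- The integer `u.val` of a unit `u ∈ (ℤ/p^K)^×`, `1 ≤ K`, is prime to `p`. [folklore] -/
theorem coprime_val_units {K : ℕ} (hK : 1 ≤ K) (u : (ZMod (p ^ K))ˣ) :
    ((u : ZMod (p ^ K)).val).Coprime p :=
  (ZMod.val_coe_unit_coprime u).coprime_dvd_right (dvd_pow_self p (by omega))

/-- A symbol that is `ℤ`-PERIODIC on `ℤ[1/p]` (hypothesis (S1) in the restricted form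
`Φ(a/p^k + z) = Φ(a/p^k)`, `a z : ℤ`) only depends, at `a/p^k`, on `a mod p^k`. [folklore] -/
theorem symbol_div_pow_eq_of_castHom
    (hper : ∀ (n : ℕ) (a z : ℤ), Φ ((a : ℚ) / (p : ℚ) ^ n + z) = Φ ((a : ℚ) / (p : ℚ) ^ n))
    {k K : ℕ} (h : k ≤ K) (a : ZMod (p ^ K)) :
    Φ ((a.val : ℚ) / (p : ℚ) ^ k) =
      Φ (((ZMod.castHom (pow_dvd_pow p h) (ZMod (p ^ k)) a).val : ℚ) / (p : ℚ) ^ k) := by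
  haveI : NeZero (p ^ K) := ⟨pow_ne_zero _ (Fact.out : p.Prime).ne_zero⟩
  haveI : NeZero (p ^ k) := ⟨pow_ne_zero _ (Fact.out : p.Prime).ne_zero⟩
  rw [ZMod.castHom_apply, ZMod.cast_eq_val, ZMod.val_natCast]
  have hdiv : a.val % p ^ k + p ^ k * (a.val / p ^ k) = a.val := Nat.mod_add_div _ _
  have hp0 : ((p : ℚ) ^ k) ≠ 0 := pow_ne_zero _ (Nat.cast_ne_zero.mpr (Fact.out : p.Prime).ne_zero)
  have hq : (a.val : ℚ) / (p : ℚ) ^ k =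
      ((a.val % p ^ k : ℕ) : ℚ) / (p : ℚ) ^ k + ((a.val / p ^ k : ℕ) : ℚ) := by
    conv_lhs => rw [← hdiv]
    push_cast
    field_simp
  have h := hper k (a.val % p ^ k : ℕ) (a.val / p ^ k : ℕ)
  simp only [Int.cast_natCast] at h
  rw [hq, h]

/-- **Evaluation at a primitive character of level `p^{k+1}`** (Mazur–Tate–Teitelbaum 1986, §I.14,
proof of (14.3), case `p ∣ N`): `∑_{a mod p^{k+1}} χ(a) α^{-(k+1)} Φ(a/p^{k+1})` equals
`α^{-(k+1)} ∑_a ∑_b χ(a) η(b) [a/p^{k+1} + b/p^c]⁺_f = e_{k+1}(α) · untwistSymbolSum p f η χ`: by the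
deprivation identity (S3), `Φ(a/p^{k+1}) = H(a/p^{k+1}) + (α/p) Φ(a/p^k)`, and the second term drops out
since `Φ(a/p^k)` only depends on `a mod p^k` (S1) while the coset sums of the PRIMITIVE `χ` modulo `p^k`
vanish (tree `sum_fiber_eq_zero_of_not_factorsThrough`).
[cite: MazurTateTeitelbaum1986Invent, §I.14] [cite: Bellaiche2021, Thm. 6.7.9] -/
theorem sum_mul_symbolMeasure_succ {N : ℕ} (f : CuspForm (CongruenceSubgroup.Gamma0 N) 2)
    (hper : ∀ (n : ℕ) (a z : ℤ), Φ ((a : ℚ) / (p : ℚ) ^ n + z) = Φ ((a : ℚ) / (p : ℚ) ^ n))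
    (hdep : ∀ (n : ℕ) (a : ℤ), Φ ((a : ℚ) / (p : ℚ) ^ n) - α / p * Φ (p * ((a : ℚ) / (p : ℚ) ^ n)) =
      ∑ b : ZMod (p ^ c), η b *
        algebraMap ℚ ℂ_[p] (ratPlusSymbol f ((a : ℚ) / (p : ℚ) ^ n + (b.val : ℚ) / (p : ℚ) ^ c)))
    (hν : ∀ (L : ℕ) (a : ZMod (p ^ L)), ν L a = α⁻¹ ^ L * Φ ((a.val : ℚ) / (p : ℚ) ^ L))
    (k : ℕ) (χ : DirichletCharacter ℂ_[p] (p ^ (k + 1))) (hχ : χ.IsPrimitive) :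
    ∑ a : ZMod (p ^ (k + 1)), χ a * ν (k + 1) a =
      untwistMultiplier p α (k + 1) * untwistSymbolSum p f η χ := by
  classical
  haveI : NeZero (p ^ (k + 1)) := ⟨pow_ne_zero _ (Fact.out : p.Prime).ne_zero⟩
  haveI : NeZero (p ^ k) := ⟨pow_ne_zero _ (Fact.out : p.Prime).ne_zero⟩
  have hp0 : (p : ℚ) ≠ 0 := Nat.cast_ne_zero.mpr (Fact.out : p.Prime).ne_zero
  -- (S3) at `r = a/p^{k+1}`: `Φ(a/p^{k+1}) = H(a/p^{k+1}) + (α/p) Φ(a/p^k)`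
  have hS3 : ∀ a : ZMod (p ^ (k + 1)), Φ ((a.val : ℚ) / (p : ℚ) ^ (k + 1)) =
      (∑ b : ZMod (p ^ c), η b * algebraMap ℚ ℂ_[p]
        (ratPlusSymbol f ((a.val : ℚ) / (p : ℚ) ^ (k + 1) + (b.val : ℚ) / (p : ℚ) ^ c))) +
        α / p * Φ ((a.val : ℚ) / (p : ℚ) ^ k) := by
    intro a
    have h := hdep (k + 1) (a.val : ℕ)
    simp only [Int.cast_natCast] at h
    rw [show (p : ℚ) * ((a.val : ℚ) / (p : ℚ) ^ (k + 1)) = (a.val : ℚ) / (p : ℚ) ^ k by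
      field_simp; ring] at h
    rw [← h, sub_add_cancel]
  -- the second term drops out
  have hvan : ∑ a : ZMod (p ^ (k + 1)), χ a * Φ ((a.val : ℚ) / (p : ℚ) ^ k) = 0 := by
    rw [← Finset.sum_fiberwise Finset.univ (ZMod.castHom (pow_dvd_pow p k.le_succ) (ZMod (p ^ k)))]
    refine Finset.sum_eq_zero fun a₀ _ ↦ ?_
    have hconst : ∀ a ∈ univ.filter (fun a : ZMod (p ^ (k + 1)) ↦
        ZMod.castHom (pow_dvd_pow p k.le_succ) (ZMod (p ^ k)) a = a₀),
        χ a * Φ ((a.val : ℚ) / (p : ℚ) ^ k) = χ a * Φ ((a₀.val : ℚ) / (p : ℚ) ^ k) := by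
      intro a ha
      rw [symbol_div_pow_eq_of_castHom hper k.le_succ a, (Finset.mem_filter.mp ha).2]
    rw [Finset.sum_congr rfl hconst, ← Finset.sum_mul,
      sum_fiber_eq_zero_of_not_factorsThrough χ _ (not_factorsThrough_of_isPrimitive hχ
        (Nat.pow_lt_pow_right (Nat.Prime.one_lt Fact.out) k.lt_succ_self)) a₀, zero_mul]
  -- assemble
  have hmain : ∀ a : ZMod (p ^ (k + 1)), χ a * ν (k + 1) a =
      α⁻¹ ^ (k + 1) * (∑ b : ZMod (p ^ c), χ a * η b * algebraMap ℚ ℂ_[p]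
        (ratPlusSymbol f ((a.val : ℚ) / (p : ℚ) ^ (k + 1) + (b.val : ℚ) / (p : ℚ) ^ c))) +
        α⁻¹ ^ (k + 1) * (α / p) * (χ a * Φ ((a.val : ℚ) / (p : ℚ) ^ k)) := by
    intro a
    rw [hν, hS3, Finset.mul_sum]
    simp only [mul_add, Finset.mul_sum]
    congr 1
    · refine Finset.sum_congr rfl fun b _ ↦ ?_; ring
    · ring
  rw [Finset.sum_congr rfl fun a _ ↦ hmain a, Finset.sum_add_distrib, ← Finset.mul_sum,
    ← Finset.mul_sum, hvan, mul_zero, add_zero, untwistMultiplier_succ, untwistSymbolSum]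

/-- **The mass of the units at level `p`**: `∑_{a ∈ (ℤ/p)^×} ν(a + pℤ_p) = ν(ℤ_p) − ν(pℤ_p)
= Φ(0) − α⁻¹ Φ(0)` (distribution relation at level `0`; `[0/p] = 0`) — the Euler-type factor `(1 − α⁻¹)`
of the one-allowable-root case at the trivial character (Mazur–Tate–Teitelbaum 1986, §I.14; Bellaïche
Thm. 6.7.9, `e_p(g, 𝟙, 0) = 1 − α⁻¹`). [cite: MazurTateTeitelbaum1986Invent, §I.14] [cite: Bellaiche2021, Thm. 6.7.9] -/
theorem sum_units_symbolMeasure_level_one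
    (hdist : ∀ (n : ℕ) (a : ZMod (p ^ n)),
      ∑ b ∈ univ.filter (fun b : ZMod (p ^ (n + 1)) ↦
        ZMod.castHom (pow_dvd_pow p n.le_succ) (ZMod (p ^ n)) b = a), ν (n + 1) b = ν n a)
    (hν : ∀ (L : ℕ) (a : ZMod (p ^ L)), ν L a = α⁻¹ ^ L * Φ ((a.val : ℚ) / (p : ℚ) ^ L)) :
    ∑ a : (ZMod (p ^ 1))ˣ, ν 1 a = (1 - α⁻¹) * Φ 0 := by
  classical
  haveI : NeZero (p ^ 1) := ⟨pow_ne_zero _ (Fact.out : p.Prime).ne_zero⟩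
  rw [sum_units_eq_sum_filter_isUnit (F := fun a : ZMod (p ^ 1) ↦ ν 1 a)]
  have hfil : univ.filter (fun a : ZMod (p ^ 1) ↦ IsUnit a) = univ.erase 0 := by
    ext a
    simp [isUnit_iff_ne_zero_level_one]
  rw [hfil, Finset.sum_erase_eq_sub (Finset.mem_univ _)]
  -- `∑_{a mod p} ν(a + pℤ_p) = ν(ℤ_p)`
  have h0 := hdist 0 (0 : ZMod (p ^ 0))
  have hfil0 : univ.filter (fun b : ZMod (p ^ (0 + 1)) ↦
      ZMod.castHom (pow_dvd_pow p (Nat.le_succ 0)) (ZMod (p ^ 0)) b = 0) = univ :=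
    Finset.filter_true_of_mem fun b _ ↦ zmod_pow_zero_eq_zero _
  rw [hfil0] at h0
  rw [show (univ : Finset (ZMod (p ^ 1))) = (univ : Finset (ZMod (p ^ (0 + 1)))) from rfl]
  erw [h0]
  rw [hν, hν]
  simp only [ZMod.val_zero, Nat.cast_zero, zero_div, pow_zero, one_mul, pow_one]
  ring

/-- **The prescribed value at the trivial character is `(1 − α⁻¹) Φ(0)`**: for `χ` mod `p⁰ = 1`,
`e_0(α) · untwistSymbolSum p f η χ = (1 − α⁻¹)(1 − α/p)⁻¹ · ∑_b η(b)[b/p^c]⁺_f`, and by the deprivation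
identity (S3) at `r = 0`, `∑_b η(b)[b/p^c]⁺_f = Φ(0) − (α/p)Φ(0) = (1 − α/p) Φ(0)`; for `α ≠ p` the factors
`(1 − α/p)^{∓1}` cancel — this is the passage `{∞,0}_g = (1 − α/p)⁻¹{∞,0}_{f⊗η̄}` built into
`untwistMultiplier p α 0` (D1 docstring). [cite: Bellaiche2021, Thm. 6.7.9] [cite: MazurTateTeitelbaum1986Invent, §I.14] -/
theorem untwistMultiplier_zero_mul_untwistSymbolSum {N : ℕ} (f : CuspForm (CongruenceSubgroup.Gamma0 N) 2)
    (hαp : α ≠ p)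
    (hdep : ∀ (n : ℕ) (a : ℤ), Φ ((a : ℚ) / (p : ℚ) ^ n) - α / p * Φ (p * ((a : ℚ) / (p : ℚ) ^ n)) =
      ∑ b : ZMod (p ^ c), η b *
        algebraMap ℚ ℂ_[p] (ratPlusSymbol f ((a : ℚ) / (p : ℚ) ^ n + (b.val : ℚ) / (p : ℚ) ^ c)))
    (χ : DirichletCharacter ℂ_[p] (p ^ 0)) :
    untwistMultiplier p α 0 * untwistSymbolSum p f η χ = (1 - α⁻¹) * Φ 0 := by
  have hsub : Subsingleton (ZMod (p ^ 0)) := by rw [pow_zero]; infer_instance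
  have hp0 : (p : ℂ_[p]) ≠ 0 := Nat.cast_ne_zero.mpr (Fact.out : p.Prime).ne_zero
  have h1 : (1 - α / p : ℂ_[p]) ≠ 0 := by
    intro h
    apply hαp
    rw [sub_eq_zero, eq_div_iff hp0, one_mul] at h
    exact h.symm
  -- (S3) at `r = 0`
  have hS3 := hdep 0 0
  simp only [Int.cast_zero, zero_div, mul_zero, zero_add] at hS3
  rw [untwistSymbolSum, sum_zmod_pow_zero, Subsingleton.elim (0 : ZMod (p ^ 0)) 1, map_one]
  simp only [one_mul, ZMod.val_one_eq_one_mod, pow_zero, Nat.mod_one, Nat.cast_zero, zero_add,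
    div_one]
  rw [← hS3, show untwistMultiplier p α 0 = (1 - α⁻¹) * (1 - α / p)⁻¹ from rfl,
    show Φ 0 - α / p * Φ 0 = (1 - α / p) * Φ 0 by ring, mul_assoc, inv_mul_cancel_left₀ h1]

end Summit.BirchSwinnertonDyer.BirchSwinnertonDyer.Theorems.PSUntwistExistence

end
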